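import Summits.AtomisticToContinuum.FouriersLaw.Theses.HeatModeWeylLaw

/-!
# `GibbsKernelInvariant` — the Gibbs measure is invariant for the equilibrium transition kernels

Closes item `stmt-AtomisticToContinuum-12399`, the support decl `GibbsKernelInvariant` of the route
`Summits/AtomisticToContinuum/FouriersLaw/Theses/HeatModeWeylLaw`: for `pinnedChain ω₂ lam β γ` (all four
parameters positive), `T > 0`, `N ≥ 1` and `t ≥ 0`,
`(gibbsMeasure N T).bind (transitionKernel N T T t) = gibbsMeasure N T`.

Proof: at equal bath temperatures the Gibbs measure is a weak (Fokker–Planck) steady state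
(`pinnedChain_isSteadyState_gibbsMeasure`, Bonetto–Lebowitz–Rey-Bellet 2000 §4.1 /
Cuneo–Eckmann–Hairer–Rey-Bellet 2018 §3.1), and every weak steady state of the pinned chain is an invariant
measure of the constructed transition semigroup `pinnedChainSemigroup`
(`pinnedChain_isInvariant_of_isSteadyState`: Hörmander smooth density, pointwise `L̂ρ + 2γρ = 0`, Lebesgue
duality and the integrated Duhamel bound), whose kernels are the transition kernels
(`pinnedChainSemigroup_kernel`, `rfl`).
-/

namespace Summit.AtomisticToContinuum.FouriersLaw.Theorems

open Literature.MathematicalPhysics.KineticTheory.HeatConduction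
open Literature.MathematicalPhysics.KineticTheory

/-- **GibbsKernelInvariant — invariance of the Gibbs measure under the equilibrium Langevin kernels.**
For `pinnedChain ω₂ lam β γ` (`ω₂, lam, β, γ > 0`), `T > 0`, `N ≥ 1` and every `t : ℝ≥0`,
`(gibbsMeasure N T).bind (transitionKernel N T T t) = gibbsMeasure N T`: the Gibbs measure is a weak steady
state at equal temperatures and weak steady states of the pinned chain are invariant for the transition
semigroup. [cite: CuneoEckmannHairerReyBellet2018, §3.1, proof of Prop. 3.3 and Thm 2.13] -/
theorem gibbsKernelInvariant_proof :
    Summit.AtomisticToContinuum.FouriersLaw.Theses.HeatModeWeylLaw.GibbsKernelInvariant := by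
  intro ω₂ lam β γ hω hl hβ hγ T hT N hN t
  have hN' : 0 < N := Nat.lt_of_lt_of_le Nat.zero_lt_one hN
  have hinv := pinnedChain_isInvariant_of_isSteadyState hω hl hβ hγ hN' hT hT
    (pinnedChain_isSteadyState_gibbsMeasure hω hl.le hβ.le γ N hT)
  exact hinv t

end Summit.AtomisticToContinuum.FouriersLaw.Theorems
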